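import Mathlib.FieldTheory.IsAlgClosed.Basic
import Mathlib.FieldTheory.Separable
import Mathlib.Algebra.Polynomial.FieldDivision
import Mathlib.Algebra.Polynomial.Degree.SmallDegree
import Literature.NumberTheory.GaloisRepresentations.WeakAbelianDirectSummandDivisibilityProofs
import HarnessLib

/-!
# Weak abelian direct summands: `E'`-rationality of `ψ(Frob_v)` from that of `ψ^N` and `ρ` (proofs)

Topic `NumberTheory/GaloisRepresentations`; namespace
`Literature.NumberTheory.GaloisRepresentations`.  A *proofs* file (theorems only; no definition,
no named fact), sibling of `WeakAbelianDirectSummand.lean` (Böckle–Hui 2025; the named fact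
`exists_heckeCharacter_of_weaklyDivides` = Thm. 1.1).

The last step of the printed proof of BH Prop. 2.11 (the `E'`-rationality of a weak abelian
direct summand on a density-one set), in the character case `m = 1`: "Therefore, for any
`v ∈ 𝓛_K` the polynomial `∏_{i=1}^m (T - χ_i(Frob_v)) ∈ E'[T]` because it is the greatest common
divisor of `∏_{i=1}^m (T^N - χ_i(Frob_v)^N)` and `det(ρ_ℓ(Frob_v) - T·Id)` in `E'[T]`."  Here
`𝓛_K` is the set of places at which `(ρ_ℓ ⊗ ψ_ℓ⁻¹)(Frob_v)` has no eigenvalue in `μ_N ∖ {1}`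
(that `𝓛_K` has density one is the algebraic Chebotarev theorem for the connected reductive
monodromy group `H_ℓ`, not treated here).

* `mem_range_of_pow_eq_of_isRoot` — **gcd descent**: `e : E' → F` a field embedding into an
  algebraically closed field, `N ≠ 0` in `F`, `a ∈ F` with `a^N ∈ e(E')`, `Q ∈ E'[X]` with
  `Q^e(a) = 0` and such that no `ζ a`, `ζ ∈ μ_N ∖ {1}`, is a root of `Q^e`.  Then `a ∈ e(E')`:
  `g = gcd(X^N - a^N, Q) ∈ E'[X]` (computed in `E'[X]`, Bezout), `g^e` is separable (it divides
  `X^N - a^N`) with `a` as its only root, so `g` is linear and `a = -g₀/g₁ ∈ e(E')`.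
* `FramedGaloisRep.WeaklyDivides.apply_mem_range_of_pow_eq` — **BH Prop. 2.11, last step
  (`m = 1`)**: if the character `ψ` weakly divides `ρ`, `ρ` has Frobenius characteristic polynomial
  `Q^e ∈ e(E'[X])` at `v`, `σ` is an arithmetic Frobenius above `v` with `ψ(σ)^N ∈ e(E')`, and
  `ρ(σ)` has no eigenvalue `ζ ψ(σ)` with `ζ ∈ μ_N ∖ {1}` (i.e. `(ρ ⊗ ψ⁻¹)(σ) ∉ Y_ℓ`), then
  `ψ(σ) ∈ e(E')` (`ψ(σ)` is a root of `Q^e` by Prop. 2.4, `charpoly_dvd_charpoly_of_weaklyDivides`).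

## References

* G. Böckle, C.-Y. Hui, Math. Ann. 393 (2025), Prop. 2.11 and its proof (last paragraph).
  [BockleHui2025]
-/

noncomputable section

open scoped NumberField Matrix
open NumberField Field IsDedekindDomain Polynomial Filter

namespace Literature.NumberTheory.GaloisRepresentations

/-! ### gcd descent -/

section GcdDescent

/-- **gcd descent.**  Let `e : E' → F` be a ring map from a field into an algebraically closed
field, `N` a natural number with `N ≠ 0` in `F`, `a ∈ F` and `b ∈ E'` with `a^N = e(b)`, and
`Q ∈ E'[X]` a polynomial having `a` as a root of `Q^e` and such that for `ζ^N = 1`, `ζ a` is a root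
of `Q^e` only if `ζ = 1`.  Then `a ∈ e(E')`: the gcd `g` of `X^N - b` and `Q` in `E'[X]` maps to
a separable polynomial (a divisor of `X^N - a^N`, Mathlib `Polynomial.separable_X_pow_sub_C`)
vanishing at `a` (Bezout, `EuclideanDomain.gcd_eq_gcd_ab`) all of whose roots are `a`, hence `g`
is linear and `a = e(-g₀/g₁)`.  This is the mechanism of the last step of the proof of
Böckle–Hui's Prop. 2.11 ("the polynomial `∏ (T - χ_i(Frob_v)) ∈ E'[T]` because it is the greatest
common divisor of `∏ (T^N - χ_i(Frob_v)^N)` and `det(ρ_ℓ(Frob_v) - T·Id)` in `E'[T]`").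
[cite: BockleHui2025, Proposition 2.11 (proof)] -/
theorem mem_range_of_pow_eq_of_isRoot {E' F : Type*} [Field E'] [Field F] [IsAlgClosed F]
    (e : E' →+* F) {N : ℕ} (hN : (N : F) ≠ 0) {a : F} {b : E'} (hab : a ^ N = e b)
    {Q : E'[X]} (hQa : (Q.map e).IsRoot a)
    (hζ : ∀ ζ : F, ζ ^ N = 1 → (Q.map e).IsRoot (ζ * a) → ζ = 1) :
    a ∈ e.range := by
  classical
  rcases eq_or_ne a 0 with rfl | ha
  · exact ⟨0, map_zero e⟩
  have hN0 : N ≠ 0 := by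
    rintro rfl
    exact hN Nat.cast_zero
  set P : E'[X] := X ^ N - C b with hP
  have hPmap : P.map e = X ^ N - C (a ^ N) := by
    rw [hP, Polynomial.map_sub, Polynomial.map_pow, map_X, map_C, hab]
  have hP0 : P ≠ 0 := X_pow_sub_C_ne_zero (Nat.pos_of_ne_zero hN0) b
  set g : E'[X] := EuclideanDomain.gcd P Q with hg
  have hg0 : g ≠ 0 := fun h0 => hP0 (EuclideanDomain.gcd_eq_zero_iff.mp h0).1
  have hgP : g ∣ P := EuclideanDomain.gcd_dvd_left P Q
  have hgQ : g ∣ Q := EuclideanDomain.gcd_dvd_right P Q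
  have hge0 : g.map e ≠ 0 := (Polynomial.map_ne_zero_iff e.injective).mpr hg0
  -- `a` is a root of `g^e` (Bezout)
  have hPa : (P.map e).eval a = 0 := by
    rw [hPmap, eval_sub, eval_pow, eval_X, eval_C, sub_self]
  have hga : (g.map e).IsRoot a := by
    rw [IsRoot.def, hg, EuclideanDomain.gcd_eq_gcd_ab P Q, Polynomial.map_add, Polynomial.map_mul,
      Polynomial.map_mul, eval_add, eval_mul, eval_mul, hPa, IsRoot.def.mp hQa, zero_mul,
      zero_mul, add_zero]
  -- `g^e` is separable (it divides `X^N - a^N`)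
  have hgPmap : g.map e ∣ X ^ N - C (a ^ N) := by
    rw [← hPmap]
    exact Polynomial.map_dvd e hgP
  have hsep : (g.map e).Separable :=
    (separable_X_pow_sub_C (a ^ N) hN (pow_ne_zero _ ha)).of_dvd hgPmap
  -- every root of `g^e` is `a`
  have hroots : ∀ r ∈ (g.map e).roots, r = a := by
    intro r hr
    have hr' : (g.map e).IsRoot r := (mem_roots hge0).mp hr
    have hrP : r ^ N = a ^ N := by
      have h2 : (X ^ N - C (a ^ N) : F[X]).IsRoot r := hr'.dvd hgPmap
      rwa [IsRoot.def, eval_sub, eval_pow, eval_X, eval_C, sub_eq_zero] at h2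
    have hrQ : (Q.map e).IsRoot r := hr'.dvd (Polynomial.map_dvd e hgQ)
    have hz : (r / a) ^ N = 1 := by rw [div_pow, hrP, div_self (pow_ne_zero _ ha)]
    have h3 := hζ (r / a) hz (by rwa [div_mul_cancel₀ r ha])
    rwa [div_eq_one_iff_eq ha] at h3
  -- hence `g^e` has the single simple root `a` and degree `1`
  have hmem : a ∈ (g.map e).roots := (mem_roots hge0).mpr hga
  have hcard : Multiset.card (g.map e).roots = 1 := by
    have hnd := nodup_roots hsep
    have hcount : (g.map e).roots.count a = Multiset.card (g.map e).roots :=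
      Multiset.count_eq_card.mpr fun r hr => (hroots r hr).symm
    have hle : (g.map e).roots.count a ≤ 1 := Multiset.nodup_iff_count_le_one.mp hnd a
    have hpos : 0 < Multiset.card (g.map e).roots := Multiset.card_pos_iff_exists_mem.mpr ⟨a, hmem⟩
    omega
  have hdeg : (g.map e).natDegree = 1 := by
    rw [← IsAlgClosed.card_roots_eq_natDegree, hcard]
  have hdeg' : g.natDegree = 1 := by rwa [Polynomial.natDegree_map] at hdeg
  -- descend: `g = g₁ X + g₀` with `g₁ ≠ 0`, and `e(g₁) a + e(g₀) = 0`
  have hg1 : g = C (g.coeff 1) * X + C (g.coeff 0) :=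
    eq_X_add_C_of_degree_le_one (by rw [degree_eq_natDegree hg0, hdeg']; exact le_rfl)
  have hc1 : g.coeff 1 ≠ 0 := by
    have h := leadingCoeff_ne_zero.mpr hg0
    rwa [leadingCoeff, hdeg'] at h
  have heval : e (g.coeff 1) * a + e (g.coeff 0) = 0 := by
    have h := hga
    rw [hg1, IsRoot.def, Polynomial.map_add, Polynomial.map_mul, map_C, map_X, map_C, eval_add,
      eval_mul, eval_C, eval_X, eval_C] at h
    exact h
  refine ⟨-(g.coeff 0) / g.coeff 1, ?_⟩
  have he1 : e (g.coeff 1) ≠ 0 := (map_ne_zero e).mpr hc1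
  rw [map_div₀, map_neg, div_eq_iff he1]
  linear_combination -heval

end GcdDescent

/-! ### BH Prop. 2.11, last step, for a character -/

namespace FramedGaloisRep

variable {K : Type} [Field K] [NumberField K] {F : Type*} [Field F] [IsAlgClosed F] [CharZero F]
  [TopologicalSpace F] [IsTopologicalRing F] [T2Space F] {n : ℕ} {E' : Type*} [Field E']

/-- **Böckle–Hui, Prop. 2.11, last step (`m = 1`): `ψ(Frob_v) ∈ E'` off the exceptional
eigenvalue locus.**  Let `F` be an algebraically closed Hausdorff topological field of
characteristic `0` (e.g. `ℚ̄_ℓ`), `e : E' → F` a field embedding, `ρ : Γ_K →ₜ* GL_n(F)` with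
Frobenius characteristic polynomial `Q^e`, `Q ∈ E'[X]`, at the place `v`, and `ψ : Γ_K →ₜ* GL_1(F)`
a character weakly dividing `ρ` (BH Def. 2.3).  Let `σ` be an arithmetic Frobenius at a prime
above `v` such that `ψ(σ)^N = e(b)` for some `b ∈ E'`, `N ≥ 1` (as when `ψ^N` is `E'`-rational at
`v`), and such that `ρ(σ)` has no eigenvalue of the form `ζ ψ(σ)` with `ζ ∈ μ_N ∖ {1}` (i.e.
`(ρ ⊗ ψ⁻¹)(σ) ∉ Y_ℓ` in the notation of the printed proof).  Then `ψ(σ) ∈ e(E')`: `ψ(σ)` is a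
root of `Q^e` (Prop. 2.4, `charpoly_dvd_charpoly_of_weaklyDivides`) and
`mem_range_of_pow_eq_of_isRoot` applies ("for any `v ∈ 𝓛_K` the polynomial `T - χ_1(Frob_v)` lies
in `E'[T]` because it is the greatest common divisor of `T^N - χ_1(Frob_v)^N` and
`det(ρ_ℓ(Frob_v) - T·Id)` in `E'[T]`").  The density-one statement for
`𝓛_K = {v : (ρ ⊗ ψ⁻¹)(Frob_v) ∉ Y_ℓ}` (algebraic Chebotarev for the connected monodromy group
`H_ℓ`) is not addressed here. [cite: BockleHui2025, Proposition 2.11 (proof)] -/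
theorem WeaklyDivides.apply_mem_range_of_pow_eq (e : E' →+* F) {ρ : FramedGaloisRep K F n}
    {ψ : FramedGaloisRep K F 1} (h : ψ.WeaklyDivides ρ) {v : HeightOneSpectrum (𝓞 K)}
    {Q : E'[X]} (hρv : ρ.HasFrobCharpolyAt v (Q.map e)) {𝔓 : Ideal (absIntegers (𝓞 K) K)}
    (h𝔓 : 𝔓 ∈ v.primesAbove) {σ : absoluteGaloisGroup K} (hσ : IsArithFrobAt (𝓞 K) σ 𝔓)
    {N : ℕ} (hN : N ≠ 0) {b : E'}
    (hb : (((ψ σ : GL (Fin 1) F) : Matrix (Fin 1) (Fin 1) F) 0 0) ^ N = e b)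
    (hY : ∀ ζ : F, ζ ^ N = 1 →
      (Q.map e).IsRoot (ζ * ((ψ σ : GL (Fin 1) F) : Matrix (Fin 1) (Fin 1) F) 0 0) → ζ = 1) :
    (((ψ σ : GL (Fin 1) F) : Matrix (Fin 1) (Fin 1) F) 0 0) ∈ e.range := by
  have hroot : (Q.map e).IsRoot (((ψ σ : GL (Fin 1) F) : Matrix (Fin 1) (Fin 1) F) 0 0) := by
    have hd := (charpoly_dvd_charpoly_iff_eval_eq_zero ψ ρ σ).mp
      (charpoly_dvd_charpoly_of_weaklyDivides ψ ρ h σ)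
    rw [hρv 𝔓 h𝔓 σ hσ] at hd
    exact hd
  exact mem_range_of_pow_eq_of_isRoot e (Nat.cast_ne_zero.mpr hN) hb hroot hY

end FramedGaloisRep

end Literature.NumberTheory.GaloisRepresentations
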